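import Mathlib
import Summits.Ventures.PercRepro2.TypedPendant
import Summits.Ventures.PercRepro2.StarGlue
import Summits.Ventures.PercRepro2.TypedUntouched
import Summits.Ventures.PercRepro2.TypedCoincidenceOB
import Summits.Ventures.PercRepro2.HCovTyped
import Summits.Ventures.PercRepro2.PendantLin

/-!
# A pole pendant at the other pole: row 2′TRI without a certificate (blind cell PercRepro2,
mine-2 g39, 2026-08-28; `proofs/MINE2-GLUE.md` §8, row M2-84)

When the only edge `e` at `o` leads to `b`, night-3's typed pendant rule
(`TypedRed.typedCount_pendant_o`: a pendant `o` of type `k` contributes the factor `C(2, k − 1)`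
and its edge becomes pinned open) reduces every typed count to a nonnegative multiple of the
count with `e` pinned open — and with `e` open `o` has exactly the sides of `b`, so the kernel is
the coincidence kernel `K₃` at `b = o` (`K3_eq_coincidence`), whose typed counts p3 proved
nonnegative pointwise (`typedCount_nonneg_of_o_eq_b`, `TypedCoincidenceOB.lean`).  With `e`
pinned closed `o` is isolated and the count is `0` (`KB_zeroO`).
**`typedCount_nonneg_of_pendant_at_b`**, **`TypedBases_of_pendant_at_b`**,
**`HCov_of_pendant_at_b`**: row 2′TRI and (HCOV) for every admissible weight vector on every
finite graph whose pole `o` hangs at `b` by a single edge — the typed form of mine-2 g13's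
`PendantOB.HCov_pendant_o_at_b`, and the `o`-pattern `{b}` of `proofs/MINE2-GADGET.md` §7 by
the cell's reduction rules instead of a finite table.  Own code; standard axioms.
-/

namespace Summit.Ventures.PercRepro2

open UnionCluster

namespace CovForm

namespace OStar

open OneTyped Untouched TypedRed StarGlue RootBridge

section AtB

open Classical

variable {V : Type*} {E : Type*} [Fintype E] [DecidableEq E] {R : Type*} [Field R]
  [LinearOrder R] [IsStrictOrderedRing R]
variable {ends : E → Sym2 V} {o a₁ a₂ a₃ b : V} {e : E}
  [DecidablePred (· ∈ (touches ends {o})ᶜ)]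

omit [Fintype E] [DecidableEq E] [DecidablePred (· ∈ (touches ends {o})ᶜ)] [LinearOrder R]
  [IsStrictOrderedRing R] in
/-- With the edge `o–b` open, the kernel is the coincidence kernel at `b = o`. -/
lemma K3_eq_coincidence (hend : ends e = s(o, b)) {x y w : Config E} (hx : x e = true)
    (hy : y e = true) (hw : w e = true) :
    (K3 ends o a₁ a₂ a₃ b x y w : R) = K3 ends o a₁ a₂ a₃ o x y w := by
  have key : ∀ {v : Config E}, v e = true → ∀ m, (Conn ends v m b ↔ Conn ends v m o) := by
    intro v hv m
    have hob : Conn ends v o b := conn_of_openAdj ⟨e, hv, hend⟩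
    exact ⟨fun h => conn_trans h (conn_symm hob), fun h => conn_trans h hob⟩
  have hst : ∀ {v : Config E}, v e = true →
      st ends o a₁ a₂ a₃ b v = st ends o a₁ a₂ a₃ o v := by
    intro v hv
    unfold st
    simp only [Prod.mk.injEq, true_and]
    exact ⟨decide_eq_decide.2 (key hv a₁), decide_eq_decide.2 (key hv a₂), trivial⟩
  rw [K3_eq_KB, K3_eq_KB, hst hx, hst hy, hst hw]

omit [Fintype E] [DecidableEq E] [LinearOrder R] [IsStrictOrderedRing R] in
/-- With `e` closed `o` is isolated: the state has an empty `o`-part. -/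
lemma st_eq_zeroO' (hleaf : ∀ e', o ∈ ends e' → e' = e) (h1 : a₁ ≠ o)
    (h2 : a₂ ≠ o) {x : Config E} (hx : x e = false) :
    st ends o a₁ a₂ a₃ b x = zeroO (st ends o a₁ a₂ a₃ b x) := by
  have hiso : ∀ m, m ≠ o → ¬ Conn ends x m o := by
    intro m hm
    have hcs : closeStar ends o x = x := by
      funext e'
      by_cases ho : o ∈ ends e'
      · rw [closeStar_apply_of_mem ho, hleaf e' ho, hx]
      · exact closeStar_apply_of_not_mem ho
    rw [← hcs]
    exact not_conn_closeStar hm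
  unfold st zeroO
  simp only [St.q', St.Lb, St.Hb, St.L3, St.H3, Prod.mk.injEq, true_and, and_true]
  exact ⟨decide_eq_false (hiso a₁ h1), decide_eq_false (hiso a₂ h2)⟩

omit [LinearOrder R] [IsStrictOrderedRing R] in
/-- With the pendant edge pinned closed every typed count vanishes (`o` is isolated). -/
lemma typedCount_eq_zero_of_pendant_closed
    (hleaf : ∀ e', o ∈ ends e' → e' = e) (h1 : a₁ ≠ o) (h2 : a₂ ≠ o) (F : Finset E) (he : e ∉ F)
    (z : Config E) (hz : z e = false) (τ : E → ℕ) :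
    typedCount F z τ (K3 ends o a₁ a₂ a₃ b : Config E → Config E → Config E → R) = 0 := by
  rw [typedCount_congr_on_support F z τ (K' := fun _ _ _ => (0 : R)) fun x y w hc _ => ?_]
  · unfold typedCount; simp
  · have hx : x e = false := by rw [(hc e he).1, hz]
    have hy : y e = false := by rw [(hc e he).2.1, hz]
    have hw : w e = false := by rw [(hc e he).2.2, hz]
    rw [K3_eq_KB, st_eq_zeroO' hleaf h1 h2 hx, st_eq_zeroO' hleaf h1 h2 hy,
      st_eq_zeroO' hleaf h1 h2 hw, KB_zeroO]
    simp

/-- **Row 2′TRI when `o` hangs at `b`**: every typed base is nonnegative. -/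
theorem typedCount_nonneg_of_pendant_at_b (hend : ends e = s(o, b))
    (hleaf : ∀ e', o ∈ ends e' → e' = e) (h1 : a₁ ≠ o) (h2 : a₂ ≠ o) (h3 : a₃ ≠ o) (hb : b ≠ o)
    (F : Finset E) (z : Config E) (τ : E → ℕ) (hτ : ∀ e' ∈ F, τ e' = 1 ∨ τ e' = 2) :
    0 ≤ typedCount F z τ (K3 ends o a₁ a₂ a₃ b : Config E → Config E → Config E → R) := by
  by_cases he : e ∈ F
  · rw [typedCount_pendant_o ends o a₁ a₂ a₃ b hend hleaf hb.symm h1.symm h2.symm h3.symm hb.symm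
      F he z τ (by rcases hτ e he with h | h <;> omega)]
    refine mul_nonneg (by positivity) ?_
    rw [typedCount_type_three F e he z _ (Function.update_self ..)]
    have hne : e ∉ F.erase e := Finset.notMem_erase e F
    rw [typedCount_congr_on_support _ _ _ fun x y w hc _ => K3_eq_coincidence (R := R) hend
      (by rw [(hc e hne).1]; simp) (by rw [(hc e hne).2.1]; simp) (by rw [(hc e hne).2.2]; simp)]
    exact typedCount_nonneg_of_o_eq_b ends o a₁ a₂ a₃ (F.erase e) _ _ fun e' he' => by
      rw [Function.update_of_ne (Finset.ne_of_mem_erase he')]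
      exact hτ e' (Finset.mem_of_mem_erase he')
  · cases hz : z e
    · rw [typedCount_eq_zero_of_pendant_closed hleaf h1 h2 F he z hz τ]
    · rw [typedCount_congr_on_support _ _ _ fun x y w hc _ => K3_eq_coincidence (R := R) hend
        (by rw [(hc e he).1, hz]) (by rw [(hc e he).2.1, hz]) (by rw [(hc e he).2.2, hz])]
      exact typedCount_nonneg_of_o_eq_b ends o a₁ a₂ a₃ F z τ hτ

/-- **The typed bases when `o` hangs at `b`.** -/
theorem TypedBases_of_pendant_at_b (hend : ends e = s(o, b)) (hleaf : ∀ e', o ∈ ends e' → e' = e)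
    (h1 : a₁ ≠ o) (h2 : a₂ ≠ o) (h3 : a₃ ≠ o) (hb : b ≠ o) : TypedBases (R := R) ends o a₁ a₂ a₃ b :=
  fun F z τ hτ => typedCount_nonneg_of_pendant_at_b hend hleaf h1 h2 h3 hb F z τ hτ

/-- **(HCOV) when `o` hangs at `b`**, for every admissible weight vector. -/
theorem HCov_of_pendant_at_b (hend : ends e = s(o, b)) (hleaf : ∀ e', o ∈ ends e' → e' = e)
    (h1 : a₁ ≠ o) (h2 : a₂ ≠ o) (h3 : a₃ ≠ o) (hb : b ≠ o) (p : E → R) (hp : IsProbVec p) :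
    HCov p ends o a₁ a₂ a₃ b :=
  HCov_of_typedBases ends o a₁ a₂ a₃ b (TypedBases_of_pendant_at_b hend hleaf h1 h2 h3 hb) p hp

end AtB

end OStar

end CovForm

end Summit.Ventures.PercRepro2
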